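import Literature.MathematicalPhysics.QuantumFieldTheory.Balaban1983to89.Node00.RateRecordW1Reading
import Literature.MathematicalPhysics.QuantumFieldTheory.Balaban1983to89.B12BetaHolo

/-!
# NODE 00 — THE MAPS OF THE W1 READING: the level pairing OF RECORD and the small-field-tower DICTIONARY of W1's (2.13) terms

Third module of the definer seat `pub-ymgap-node00-def-W1` (g3), after `Node00.HistoryTermsOfRecord` (the OBJECT: [II] (2.13)–(2.14) terms
`E^{(j)}(X; g₀,…,g_{j−1}; (𝐔,𝐉))` on the record's torus catalogue, as `W1.ClusterTower` ∕ `W1.termC` ∕ `W1.functional`) and `Node00.RateRecordW1Reading`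
(the rate READING data `W1.LevelPairing` ∕ `W1.ReadingData` ∕ `W1.assignment₁₂`).  That module left two things as FREE FIELDS or UNSTATED which the
record in fact determines; this module pins them (Literature side, hypothesis-schema style: objects, `rfl` faces and by-name dictionary theorems —
nothing of Bałaban's construction is asserted).

WHAT.
* §1 THE LEVEL-SHIFT IDENTITY OF THE TORUS CATALOGUE: `domCount (F.P (k+1)) M (j+1) = domCount (F.P k) M j` (run B, started one level finer on the
  same physical torus `T_{2L^m}` — [I] (0.24)–(0.25) — has at its creation step `j + 1` run A's step-`j` lattice of `M`-cubes), hence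
  `domSys (F.P (k+1)) M (j+1) = domSys (F.P k) M j` (`domSys_succ`), the transport `castDom` along it (tree length and cube number preserved), and
  **THE DOMAIN PAIRING OF RECORD** `pairOfRecord F M k : (j, X) ↦ (j + 1, X)` (injective; range = the run-B domains of positive creation step;
  `d_{j+1}(πX) = d_j(X)`).  The pairing is NOT PRINTED ([I] compares the two runs' SUMS (0.24)–(0.25)); it is the bookkeeping convention every
  termwise two-run statement of this programme (`T4OutputRate.NE5`, dag-n18's N18) uses, now a closed term instead of a free field.
* §2 **THE LEVEL PAIRING OF RECORD** `LevelPairing.ofRecord F M k N gauge hg T₀` = g2's `LevelPairing.ofRecordA` with run B ALSO pinned: run-B backgrounds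
  `GaugeField (F.P (k+1)) 0 (SU N)` read through `ιSU N` with `𝐉 = 0`, `pair := pairOfRecord`; the closeness gauge (NE3's currency) and the one-step
  transport `T₀` ([I] (0.8)–(0.10); Summit-typed `transportRaw`, dag-n18-d) remain parameters.  `ReadingData.ofRecord` bundles it per run length with the
  towers (RESIDUAL: N10's Lemmas 1–3 objects) and the letter inputs; `rfl` faces down to `EA k g U (j,X) = Re E^{(j)}(X; g; (ιU,0))`,
  `EB k b g U (j,X) = Re E^{(j+1)}(πX; b∷g; (ιU,0))` on the `(k+1)`-th torus, and `ne5_ofRecord_iff` (NE5 at the reading of record, `Iff.rfl`).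
* §3 **THE SMALL-FIELD-TOWER DICTIONARY** (asked for on the bus by dag-n22-c g2 HANDOFF (t2) and named in `…N22W1StripMixed`'s framing «the record's
  identification of N09's `SFTower.E (k+1) X t φ` with `W1.termC S (k+1) X (g|g_k:=t) φ` — definer lane»): `lastSection S g` (the term of creation step `j`
  as a function of its LAST young coupling, the older ones frozen at the history `g` — [I] (1.7)'s `E^{(j)}(X, g_{j−1}, ·)` with p.256's remark that it
  depends on all preceding couplings) and `sfTowerOfRecord Sg Rz M S fl logZ : Step.SFTower P G (CPair P 𝔸) (Site P 0 → Gc)` on def-T's frame of record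
  (`Sect2.domSys`, `Sect2.spaceI`, `ofBackgroundC Sg.ι`, `cAct`, `agreeOnSet` — `sfTowerOfRecord_frame_eq_towerOfTerms`), with `rfl` faces
  `E (k+1) X t φ = termC S (k+1) X (Function.update fl.g k t) φ` (`sfTowerOfRecord_E_succ`), coherence `E j X (g_{j−1}) φ = termC S j X g φ`
  (`sfTowerOfRecord_E_self`), `Etot`∕`Ek` ((1.7), (0.23)) on W1's terms; the `Step.SFHyp` clauses `localDep` ((1.7) locality) and `gaugeInv119` ((1.19))
  DISCHARGED BY NAME from `ClusterStep.LocalizedH` ∕ `ClusterStep.GaugeInvH`; and node N09's per-step currency `B12BetaHolo.EHoloAt` READ ON W1's TERMS: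
  the constructor in W1's letters (`eHoloAtOfRecord`), (1.18) for the new term at every real last coupling and at the flow's own history
  (`norm_termC_update_le_of_eHoloAt`, `norm_termC_le_of_eHoloAt`), `W1.TermBound118` along `[0, γ]^ℕ` ∕ `Window γ` from a family of `EHoloAt`'s with a
  uniform letter `E₀` (`termBound118_of_eHoloAt`, `termBound118_window_of_eHoloAt`), the two [I] p.263 coupling clauses on the W1 object ⟺ `ESmoothAt` ∕
  `EAnalyticAt` at every admissible history (`smoothInLastOfRecord_iff_eSmoothAt`, `analyticInLastOfRecord_iff_eAnalyticAt`; the analytic twin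
  `W1.AnalyticInLastOfRecord` of g0's `SmoothInLastOfRecord` is new here), both from `EHoloAt` (`smooth_and_analyticInLastOfRecord_of_eHoloAt`), and
  **dag-n22-c's last-coupling socket shape** `lastOut_of_eHoloAt`: from `EHoloAt`'s along `Window γ` with uniform `(E₀, r)`, for every `(k, g, X, φ)` an `Ec`
  holomorphic on an open `O ⊇` the closed `r`-discs about `]0, γ]`, `‖Ec‖ ≤ E₀ e^{−κ d_{k+1}(X)}` on `O`, `Ec t = termC S (k+1) X (update g k t) φ` on `]0, γ]`
  — the `hlast` binder of `…N22W1StripInductionLetters.stepOut_of_propagationOlder_lastOut` at the space table `U^c_j(X, α₀, α₁)` of record and `κ := c.κ`.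

HONEST FRAMING.  Definitions, `rfl`∕`Iff.rfl` faces and small proved glue (casts, a `Nat` division identity, monotonicity of the letters); 0 `sorry`,
0 `instance`, 0 `notation`, standard axioms.  NOTHING of [I]–[II] is asserted: the towers `S`, the gauge, the transport, `logZ`, the flow and every
`EHoloAt` are PARAMETERS ∕ HYPOTHESES.  The (2.14) Gaussian objects behind the activities are still NOT typed on the record's configuration pairs (g0's
census V2 stands); the fine-site-level correspondence of paired domains across the two tori (the one-step coarse map `T4LevelShift`) is NOT needed for the
cube-index pairing and is not made here.  Count-neutral: no node of the 27 is discharged by this file.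

References (TYPES and page anchors only): [I] = [Balaban1987RG1] T. Bałaban, *Renormalization group approach to lattice gauge field theories. I*,
Commun. Math. Phys. **109** (1987) 249–301 — (0.1) p.251, (0.8)–(0.10) p.253, (0.23)–(0.25) pp.256–257, Thm 1 p.259, (1.3)–(1.10) pp.260–262,
(1.18)–(1.19) p.263, p.266; [II] = [Balaban1988RG2Cluster] *… II. Cluster expansions*, Commun. Math. Phys. **116** (1988) 1–22 — (2.13)–(2.15) pp.14–15,
pp.21–22; [III] = [Balaban1988Convergent] *Convergent renormalization expansions …*, Commun. Math. Phys. **119** (1988) 243–285 — (2.23)–(2.27) pp.258–259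
(the frame of record).
-/

noncomputable section

open scoped BigOperators

namespace Literature.MathematicalPhysics.QuantumFieldTheory.Balaban1983to89.Node00

open Literature.MathematicalPhysics.QuantumFieldTheory.Balaban1983to89
open Step B14.Eq213MaximalDomains TreeLengthTorus T4Continuum Sect2
open Literature.MathematicalPhysics.QuantumFieldTheory.Balaban1983to89.T4OutputRate (Carriers Functional Window NE5)
open Literature.MathematicalPhysics.QuantumFieldTheory.Balaban1983to89.B12BetaHolo (EHoloAt)
open Literature.MathematicalPhysics.QuantumFieldTheory.Balaban1983to89.B12BetaSmooth (ESmoothAt EAnalyticAt)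

namespace W1

/-! ## §1  Level-shift arithmetic of the torus catalogue: run B's `𝐃_{j+1}(F.P (k+1))` and run A's `𝐃_j(F.P k)` have ONE cube-index torus -/

/-- `(L·a − 1) ∕ L = a − 1` for `0 < L·a`. [folklore] -/
private theorem mul_pred_div {L a : ℕ} (h : 0 < L * a) : (L * a - 1) / L = a - 1 := by
  have := Nat.mul_sub_div 0 L a h
  simpa using this

/-- **THE LEVEL-SHIFT IDENTITY OF THE CUBE COUNTS**: the `M`-cubes of `T^{(j+1)}` of the `(k+1)`-th torus and the `M`-cubes of `T^{(j)}` of the `k`-th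
torus have the same count per direction, `⌈2L^{m+k+1} ∕ (L^{j+1}M)⌉ = ⌈2L^{m+k} ∕ (L^j M)⌉` (run B's creation step `j + 1` has run A's step-`j` lattice
spacing: [I] (0.24)–(0.25), one physical torus `T_{2L^m}`). [cite: Balaban1987RG1, (0.1) p.251 and (0.24)-(0.25) p.257 (bookkeeping)] -/
theorem domCount_succ (F : T4Family) (M k j : ℕ) : domCount (F.P (k + 1)) M (j + 1) = domCount (F.P k) M j := by
  show ((F.P (k + 1)).sitesPerDir 0 - 1) / side (F.P (k + 1)).L M (j + 1) + 1 = ((F.P k).sitesPerDir 0 - 1) / side (F.P k).L M j + 1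
  rw [T4Family.sitesPerDir_eq, T4Family.sitesPerDir_eq, T4Family.P_L, T4Family.P_L, side_succ, ← Nat.div_div_eq_div_mul,
    show 2 * F.L ^ (F.m + (k + 1)) = F.L * (2 * F.L ^ (F.m + k)) by ring, mul_pred_div]
  have hL : 0 < F.L := by have := F.hL.2; omega
  positivity

/-- Domain systems with equal cube counts are equal (`NeZero` is a proposition) — the transport lemma behind `𝐃_{j+1}(F.P (k+1)) = 𝐃_j(F.P k)`. [cite: Balaban1987RG1, p.257 (class 𝐃_j) with (0.24)-(0.25) (bookkeeping)] -/
theorem tsys_congr {d n n' : ℕ} [NeZero n] [NeZero n'] (h : n = n') : tsys d n = tsys d n' := by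
  subst h
  rfl

/-- **`𝐃_{j+1}(F.P (k+1)) = 𝐃_j(F.P k)` AS DOMAIN SYSTEMS** (same cube-index torus, same tree length). [cite: Balaban1987RG1, p.257 (class 𝐃_j) with (0.24)-(0.25) (bookkeeping)] -/
theorem domSys_succ (F : T4Family) (M k j : ℕ) : domSys (F.P (k + 1)) M (j + 1) = domSys (F.P k) M j :=
  tsys_congr (domCount_succ F M k j)

/-- Transport of localization domains along an equality of domain systems (plumbing for the pairing of record). [cite: Balaban1987RG1, p.257 (class 𝐃_j; bookkeeping)] -/
def castDom {S₁ S₂ : LocDomainSys} (h : S₁ = S₂) (X : S₁.Dom) : S₂.Dom :=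
  cast (congrArg LocDomainSys.Dom h) X

/-- Transport along `rfl` is the identity. [cite: Balaban1987RG1, p.257 (class 𝐃_j; bookkeeping)] -/
@[simp] theorem castDom_rfl {S₁ : LocDomainSys} (X : S₁.Dom) : castDom rfl X = X := rfl

/-- The tree length `d_j(X)` is preserved under transport. [cite: Balaban1987RG1, p.257 (d_j(X); bookkeeping)] -/
@[simp] theorem dj_castDom {S₁ S₂ : LocDomainSys} (h : S₁ = S₂) (X : S₁.Dom) : S₂.dj (castDom h X) = S₁.dj X := by
  subst h
  rfl

/-- Transport back and forth is the identity. [cite: Balaban1987RG1, p.257 (class 𝐃_j; bookkeeping)] -/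
@[simp] theorem castDom_symm_castDom {S₁ S₂ : LocDomainSys} (h : S₁ = S₂) (X : S₁.Dom) : castDom h.symm (castDom h X) = X := by
  subst h
  rfl

/-- Transport forth and back is the identity. [cite: Balaban1987RG1, p.257 (class 𝐃_j; bookkeeping)] -/
@[simp] theorem castDom_castDom_symm {S₁ S₂ : LocDomainSys} (h : S₁ = S₂) (Y : S₂.Dom) : castDom h (castDom h.symm Y) = Y := by
  subst h
  rfl

/-- Transport of localization domains is injective. [cite: Balaban1987RG1, p.257 (class 𝐃_j; bookkeeping)] -/
theorem castDom_injective {S₁ S₂ : LocDomainSys} (h : S₁ = S₂) : Function.Injective (castDom h) := by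
  subst h
  exact fun _ _ e => e

/-- Transport of localization domains is a bijection. [cite: Balaban1987RG1, p.257 (class 𝐃_j; bookkeeping)] -/
def domEquiv {S₁ S₂ : LocDomainSys} (h : S₁ = S₂) : S₁.Dom ≃ S₂.Dom :=
  ⟨castDom h, castDom h.symm, castDom_symm_castDom h, castDom_castDom_symm h⟩

/-- The bijection acts by `castDom`. [cite: Balaban1987RG1, p.257 (class 𝐃_j; bookkeeping)] -/
@[simp] theorem domEquiv_apply {S₁ S₂ : LocDomainSys} (h : S₁ = S₂) (X : S₁.Dom) : domEquiv h X = castDom h X := rfl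

/-- For the torus catalogue the transport keeps the number of `M`-cubes `|X|`. [cite: Balaban1987RG1, p.257 (|X|; bookkeeping)] -/
theorem card_castDom_tsys {d n n' : ℕ} [NeZero n] [NeZero n'] (h : n = n') (X : (tsys d n).Dom) :
    (Subtype.val (castDom (tsys_congr h) X) : Finset (TPt d n')).card = (Subtype.val X : Finset (TPt d n)).card := by
  subst h
  rfl

/-- **THE DOMAIN PAIRING OF RECORD** `π : (j, X) ↦ (j + 1, X)`: run A's localization domain `X ∈ 𝐃_j(F.P k)` answers to run B's domain of creation step
`j + 1` on `F.P (k+1)` with the SAME family of cube indices (transported along `domSys_succ`) — same physical extent, run B's scale-0 step unpaired.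
(UNPRINTED convention of the two-run comparison [I] (0.24)–(0.25) ∕ Thm 1; W1 g2's `LevelPairing.pair` field, pinned.) [cite: Balaban1987RG1, (0.24)-(0.25) p.257 and Thm 1 p.259 (the pairing is NOT printed)] -/
def pairOfRecord (F : T4Family) (M k : ℕ) (X : W1.Dom (F.P k) M) : W1.Dom (F.P (k + 1)) M :=
  ⟨X.1 + 1, castDom (domSys_succ F M k X.1).symm X.2⟩

section Pairing

variable (F : T4Family) (M k : ℕ)

/-- Face: the paired domain is created one step later. [cite: Balaban1987RG1, (0.24)-(0.25) p.257 (bookkeeping)] -/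
@[simp] theorem pairOfRecord_fst (X : W1.Dom (F.P k) M) : (pairOfRecord F M k X).1 = X.1 + 1 := rfl

/-- Face: the paired domain has the same tree length `d_{j+1}(πX) = d_j(X)`. [cite: Balaban1987RG1, p.257 (d_j(X); bookkeeping)] -/
@[simp] theorem dj_pairOfRecord (X : W1.Dom (F.P k) M) :
    (domSys (F.P (k + 1)) M (X.1 + 1)).dj (pairOfRecord F M k X).2 = (domSys (F.P k) M X.1).dj X.2 :=
  dj_castDom (domSys_succ F M k X.1).symm X.2

/-- Face: the paired domain is never of creation step `0` (run B's first step is unpaired). [cite: Balaban1987RG1, (0.24)-(0.25) p.257 (bookkeeping)] -/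
theorem pairOfRecord_fst_ne_zero (X : W1.Dom (F.P k) M) : (pairOfRecord F M k X).1 ≠ 0 := Nat.succ_ne_zero _

/-- The pairing of record is injective. [cite: Balaban1987RG1, (0.24)-(0.25) p.257 (bookkeeping)] -/
theorem pairOfRecord_injective : Function.Injective (pairOfRecord F M k) := by
  rintro ⟨j, X⟩ ⟨j', X'⟩ h
  have hj : j = j' := by simpa using congrArg Sigma.fst h
  subst hj
  have hX : castDom (domSys_succ F M k j).symm X = castDom (domSys_succ F M k j).symm X' := eq_of_heq (Sigma.mk.inj h).2
  rw [castDom_injective _ hX]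

/-- Every run-B domain of creation step `j + 1` is paired with exactly run A's `(j, X)` of the same cube indices. [cite: Balaban1987RG1, (0.24)-(0.25) p.257 (bookkeeping)] -/
theorem pairOfRecord_castDom (j : ℕ) (Y : (domSys (F.P (k + 1)) M (j + 1)).Dom) :
    pairOfRecord F M k ⟨j, castDom (domSys_succ F M k j) Y⟩ = ⟨j + 1, Y⟩ := by
  simp [pairOfRecord]

/-- The range of the pairing of record is the set of run-B domains of positive creation step. [cite: Balaban1987RG1, (0.24)-(0.25) p.257 (bookkeeping)] -/
theorem range_pairOfRecord : Set.range (pairOfRecord F M k) = {Y | Y.1 ≠ 0} := by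
  ext Y
  constructor
  · rintro ⟨X, rfl⟩
    exact pairOfRecord_fst_ne_zero F M k X
  · intro hi
    obtain ⟨i, Y⟩ := Y
    obtain ⟨j, hj⟩ := Nat.exists_eq_succ_of_ne_zero hi
    dsimp only at hj
    subst hj
    exact ⟨⟨j, castDom (domSys_succ F M k j) Y⟩, pairOfRecord_castDom F M k j Y⟩

/-- Face on the carriers of record: `scale (πX) = scale X + 1` and `d (πX) = d X` for the history carriers of the two tori (any pairings).
[cite: Balaban1987RG1, (0.24)-(0.25) p.257 (bookkeeping)] -/
theorem histCarriers_scale_d_pairOfRecord (p : RunPairing) (p' : RunPairing) (X : W1.Dom (F.P k) M) :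
    (histCarriers (F.P (k + 1)) M p').scale (pairOfRecord F M k X) = (histCarriers (F.P k) M p).scale X + 1 ∧
      (histCarriers (F.P (k + 1)) M p').d (pairOfRecord F M k X) = (histCarriers (F.P k) M p).d X :=
  ⟨rfl, dj_castDom (domSys_succ F M k X.1).symm X.2⟩

/-! ## §2  The level pairing OF RECORD and the W1 reading of record -/

/-- **THE LEVEL-`k` PAIRING OF RECORD** (W1 g2's `LevelPairing` with every field the record determines PINNED): run-A backgrounds = `SU(N)`-valued gauge
fields on the fine lattice of `F.P k`, run-B backgrounds = those of `F.P (k+1)`, both read in `Φ` through `ιSU N` with `𝐉 = 0` (`Sect2.ofBackgroundC`), the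
domain pairing `π` of §1; the closeness gauge (NE3's currency, node N16's side) and the one-step transport `T₀` (Summit-typed: dag-n18-d's
`transportRaw F k (blockAvg expMeanLogSU)`, [I] (0.8)–(0.10)) stay explicit parameters. [cite: Balaban1987RG1, (0.8)-(0.10) p.253, (0.24)-(0.25) p.257 and Thm 1 p.259] -/
def LevelPairing.ofRecord (N : ℕ) (gauge : GaugeField (F.P k) 0 (SU N) → GaugeField (F.P k) 0 (SU N) → ℝ) (hg : ∀ U U', 0 ≤ gauge U U')
    (transport : GaugeField (F.P (k + 1)) 0 (SU N) → GaugeField (F.P k) 0 (SU N)) : LevelPairing F (MatA N) M k :=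
  LevelPairing.ofRecordA N k (GaugeField (F.P (k + 1)) 0 (SU N)) gauge hg transport (ofBackgroundC (ιSU N)) (pairOfRecord F M k)

section PairingFaces

variable (N : ℕ) (gauge : GaugeField (F.P k) 0 (SU N) → GaugeField (F.P k) 0 (SU N) → ℝ) (hg : ∀ U U', 0 ≤ gauge U U')
  (transport : GaugeField (F.P (k + 1)) 0 (SU N) → GaugeField (F.P k) 0 (SU N))

/-- Face: run A's backgrounds of the pairing of record. [cite: Balaban1987RG1, (0.24) p.257 (bookkeeping)] -/
theorem LevelPairing.ofRecord_BgA : (LevelPairing.ofRecord F M k N gauge hg transport).BgA = GaugeField (F.P k) 0 (SU N) := rfl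
/-- Face: run B's backgrounds of the pairing of record live on the `(k+1)`-th torus. [cite: Balaban1987RG1, (0.25) p.257 (bookkeeping)] -/
theorem LevelPairing.ofRecord_BgB : (LevelPairing.ofRecord F M k N gauge hg transport).BgB = GaugeField (F.P (k + 1)) 0 (SU N) := rfl
/-- Face: run A's backgrounds are read through `ιSU N` with `𝐉 = 0`. [cite: Balaban1987RG1, (1.9) pp.261-262 (bookkeeping)] -/
theorem LevelPairing.ofRecord_embA (U : GaugeField (F.P k) 0 (SU N)) :
    (LevelPairing.ofRecord F M k N gauge hg transport).embA U = ofBackgroundC (ιSU N) U := rfl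
/-- Face: run B's backgrounds are read through `ιSU N` with `𝐉 = 0`. [cite: Balaban1987RG1, (1.9) pp.261-262 (bookkeeping)] -/
theorem LevelPairing.ofRecord_embB (U : GaugeField (F.P (k + 1)) 0 (SU N)) :
    (LevelPairing.ofRecord F M k N gauge hg transport).embB U = ofBackgroundC (ιSU N) U := rfl
/-- Face: the domain pairing of the pairing of record IS `pairOfRecord`. [cite: Balaban1987RG1, (0.24)-(0.25) p.257 (bookkeeping)] -/
theorem LevelPairing.ofRecord_pair (X : W1.Dom (F.P k) M) : (LevelPairing.ofRecord F M k N gauge hg transport).pair X = pairOfRecord F M k X := rfl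
/-- Face: the transport is the given one-step map `T₀`. [cite: Balaban1987RG1, (0.8)-(0.10) p.253 (bookkeeping)] -/
theorem LevelPairing.ofRecord_transport (U : GaugeField (F.P (k + 1)) 0 (SU N)) :
    (LevelPairing.ofRecord F M k N gauge hg transport).transport U = transport U := rfl
/-- Face: the closeness gauge is the given one. [cite: Balaban1987RG1, (0.21)-(0.22) p.256 (bookkeeping)] -/
theorem LevelPairing.ofRecord_gauge (U U' : GaugeField (F.P k) 0 (SU N)) :
    (LevelPairing.ofRecord F M k N gauge hg transport).gauge U U' = gauge U U' := rfl

/-- **RUN A's level functional of the pairing of record IS W1's functional of record** `W1.functional (S) (ιSU N) _` (`rfl`). [cite: Balaban1987RG1, (0.24) p.257 and (1.18) p.263 (bookkeeping)] -/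
theorem LevelPairing.EA_ofRecord (S : ClusterTower (F.P k) (MatA N) M) :
    (LevelPairing.ofRecord F M k N gauge hg transport).EA S = functional S (ιSU N) (LevelPairing.ofRecord F M k N gauge hg transport).toRunPairing :=
  rfl

/-- **RUN B's first-coupling family of the pairing of record IS run B's OWN functional of record** at the paired domain and the prepended history:
`EB S′ b g U (j, X) = W1.functional S′ (ιSU N) p′ (b∷g) U (j+1, X)` for any run-B pairing literal `p′` (`rfl`). [cite: Balaban1987RG1, (0.24)-(0.25) p.257; Balaban1988RG2Cluster, (2.13) p.14 (bookkeeping)] -/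
theorem LevelPairing.EB_ofRecord (S' : ClusterTower (F.P (k + 1)) (MatA N) M) (p' : RunPairing) (b : ℝ) (g : ℕ → ℝ)
    (U : GaugeField (F.P (k + 1)) 0 (SU N)) (X : W1.Dom (F.P k) M) :
    (LevelPairing.ofRecord F M k N gauge hg transport).EB S' b g U X = functional S' (ιSU N) p' (prependCoupling b g) U (pairOfRecord F M k X) :=
  rfl

/-- The same, unfolded to the step data: run B's value at `(j, X)` is (2.13) of run B's step-`j` data `S′ j` at the young couplings `(b, g₀, …, g_{j−1})`, the
configuration `(ιU, 0)` and the transported domain. [cite: Balaban1988RG2Cluster, (2.13) p.14 (bookkeeping)] -/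
theorem LevelPairing.EB_ofRecord_apply (S' : ClusterTower (F.P (k + 1)) (MatA N) M) (b : ℝ) (g : ℕ → ℝ)
    (U : GaugeField (F.P (k + 1)) 0 (SU N)) (X : W1.Dom (F.P k) M) :
    (LevelPairing.ofRecord F M k N gauge hg transport).EB S' b g U X =
      ((S' X.1).E (restrictPrefix X.1 (prependCoupling b g)) (ofBackgroundC (ιSU N) U) (castDom (domSys_succ F M k X.1).symm X.2)).re :=
  rfl

end PairingFaces

/-- **THE W1 READING DATA OF RECORD** (colour `N`, cube size `M`): the towers of one-step cluster data per run length (RESIDUAL — N10's Lemmas 1–3 objects), the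
level pairings OF RECORD of this section with the gauge and transport tables given, the K-uniform letter inputs. [cite: Balaban1988RG2Cluster, (2.13)-(2.14) pp.14-15; Balaban1987RG1, (0.24)-(0.25) p.257] -/
def ReadingData.ofRecord (N : ℕ) (S : (k : ℕ) → ClusterTower (F.P k) (MatA N) M)
    (gauge : (k : ℕ) → GaugeField (F.P k) 0 (SU N) → GaugeField (F.P k) 0 (SU N) → ℝ) (hg : ∀ k U U', 0 ≤ gauge k U U')
    (transport : (k : ℕ) → GaugeField (F.P (k + 1)) 0 (SU N) → GaugeField (F.P k) 0 (SU N)) (li : LetterInputs) : ReadingData F (MatA N) M :=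
  ⟨S, fun k => LevelPairing.ofRecord F M k N (gauge k) (hg k) (transport k), li⟩

section ReadingFaces

variable (N : ℕ) (S : (k : ℕ) → ClusterTower (F.P k) (MatA N) M)
  (gauge : (k : ℕ) → GaugeField (F.P k) 0 (SU N) → GaugeField (F.P k) 0 (SU N) → ℝ) (hg : ∀ k U U', 0 ≤ gauge k U U')
  (transport : (k : ℕ) → GaugeField (F.P (k + 1)) 0 (SU N) → GaugeField (F.P k) 0 (SU N)) (li : LetterInputs) (γ : ℝ)

/-- Face: the towers of the reading of record are the given ones. [cite: Balaban1988RG2Cluster, (2.13) p.14 (bookkeeping)] -/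
theorem ReadingData.ofRecord_S : (ReadingData.ofRecord F M N S gauge hg transport li).S = S := rfl
/-- Face: the level pairings of the reading of record are `LevelPairing.ofRecord`. [cite: Balaban1987RG1, (0.24)-(0.25) p.257 (bookkeeping)] -/
theorem ReadingData.ofRecord_pairing :
    (ReadingData.ofRecord F M N S gauge hg transport li).pairing k = LevelPairing.ofRecord F M k N (gauge k) (hg k) (transport k) := rfl
/-- Face: the letter inputs of the reading of record are the given ones. [cite: Balaban1987RG1, Thm 1 p.259 (bookkeeping)] -/
theorem ReadingData.ofRecord_li : (ReadingData.ofRecord F M N S gauge hg transport li).li = li := rfl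

/-- **RUN A AT THE READING OF RECORD**: `EA k g U (j, X) = Re E^{(j)}(X; g₀,…,g_{j−1}; (ιU, 0))` — W1's functional of record of the `k`-th torus. [cite: Balaban1987RG1, (0.24) p.257 and (1.18) p.263; Balaban1988RG2Cluster, (2.13) p.14 (bookkeeping)] -/
theorem ReadingData.u3Objects_ofRecord_EA_apply (g : ℕ → ℝ) (U : GaugeField (F.P k) 0 (SU N)) (X : W1.Dom (F.P k) M) :
    ((ReadingData.ofRecord F M N S gauge hg transport li).u3Objects γ).EA k g U X = (functionalC (S k) g (ofBackgroundC (ιSU N) U) X).re := rfl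

/-- **RUN B AT THE READING OF RECORD**: `EB k b g U (j, X) = Re E^{(j+1)}(πX; b, g₀,…,g_{j−1}; (ιU, 0))` on the `(k+1)`-th torus. [cite: Balaban1987RG1, (0.24)-(0.25) p.257; Balaban1988RG2Cluster, (2.13) p.14 (bookkeeping)] -/
theorem ReadingData.u3Objects_ofRecord_EB_apply (b : ℝ) (g : ℕ → ℝ) (U : GaugeField (F.P (k + 1)) 0 (SU N)) (X : W1.Dom (F.P k) M) :
    ((ReadingData.ofRecord F M N S gauge hg transport li).u3Objects γ).EB k b g U X =
      (functionalC (S (k + 1)) (prependCoupling b g) (ofBackgroundC (ιSU N) U) (pairOfRecord F M k X)).re := rfl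

/-- **NE5 AT THE READING OF RECORD** (`Iff.rfl` on W1 g2's `ne5_u3Objects_iff`): for every history `g ∈ W`, run-B background `U` and run-A domain `(j, X)`,
`|Re E_A^{(j)}(X; g; (ιT₀U, 0)) − Re E_B^{(j+1)}(πX; b∷g; (ιU, 0))| ≤ C₅ θ^j e^{−κ d_j(X)}` — dag-n18-d's N18 literal with `π`, the run-B side and the readings
pinned; `T₀` the given transport. [cite: Balaban1987RG1, Thm 1 p.259 and (1.18) p.263 (NE5 is NOT printed; bookkeeping)] -/
theorem ReadingData.ne5_ofRecord_iff (b : ℝ) (W : Set (ℕ → ℝ)) (κ θ C₅ : ℝ) :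
    NE5 (((ReadingData.ofRecord F M N S gauge hg transport li).u3Objects γ).EA k)
        (((ReadingData.ofRecord F M N S gauge hg transport li).u3Objects γ).EB k b) W κ θ C₅ ↔
      ∀ g ∈ W, ∀ (U : GaugeField (F.P (k + 1)) 0 (SU N)) (X : W1.Dom (F.P k) M),
        |(functionalC (S k) g (ofBackgroundC (ιSU N) (transport k U)) X).re -
            (functionalC (S (k + 1)) (prependCoupling b g) (ofBackgroundC (ιSU N) U) (pairOfRecord F M k X)).re| ≤
          C₅ * θ ^ X.1 * Real.exp (-(κ * (domSys (F.P k) M X.1).dj X.2)) :=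
  Iff.rfl

end ReadingFaces

end Pairing

/-! ## §3  The small-field-tower DICTIONARY: W1's terms as a `Step.SFTower` on the frame of record -/

section SF

variable {P : Params} {𝔸 : Type*} [NormedRing 𝔸] [NormedAlgebra ℂ 𝔸] [CompleteSpace 𝔸] {G : Type*} [GaugeGroup G]

/-- **THE LAST-COUPLING SECTIONS OF W1's TERMS AT A HISTORY `g`**: `(j, X, t, φ) ↦ E^{(j)}(X; g₀, …, g_{j−2}, t; φ)` — the term of creation step `j` with its
LAST young coupling `g_{j−1}` replaced by the variable `t` and the older ones frozen at `g` ([I] (1.7): `E^{(j)}(X, g_{j−1}, 𝐔, 𝐉)` «We write [it] as explicitly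
dependent on g_{j−1}, although it depends also on all preceding coupling constants», p.256); `0` at `j = 0`. [cite: Balaban1987RG1, (1.7) p.261 with p.256] -/
def lastSection {M : ℕ} (S : ClusterTower P 𝔸 M) (g : ℕ → ℝ) : (j : ℕ) → (domSys P M j).Dom → ℝ → CPair P 𝔸 → ℂ
  | 0, _, _, _ => 0
  | k + 1, X, t, φ => termC S (k + 1) X (Function.update g k t) φ

omit [NormedRing 𝔸] [NormedAlgebra ℂ 𝔸] [CompleteSpace 𝔸] in
/-- No term at creation step `0`. [cite: Balaban1987RG1, (0.23) p.256 (bookkeeping)] -/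
@[simp] theorem lastSection_zero {M : ℕ} (S : ClusterTower P 𝔸 M) (g : ℕ → ℝ) (X : (domSys P M 0).Dom) (t : ℝ) (φ : CPair P 𝔸) :
    lastSection S g 0 X t φ = 0 := rfl

omit [NormedRing 𝔸] [NormedAlgebra ℂ 𝔸] [CompleteSpace 𝔸] in
/-- The section at creation step `k + 1` is W1's term at the history updated in its last young coupling. [cite: Balaban1987RG1, (1.7) p.261 (bookkeeping)] -/
theorem lastSection_succ {M : ℕ} (S : ClusterTower P 𝔸 M) (g : ℕ → ℝ) (k : ℕ) (X : (domSys P M (k + 1)).Dom) (t : ℝ) (φ : CPair P 𝔸) :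
    lastSection S g (k + 1) X t φ = termC S (k + 1) X (Function.update g k t) φ := rfl

omit [NormedRing 𝔸] [NormedAlgebra ℂ 𝔸] [CompleteSpace 𝔸] in
/-- At the history's own last coupling the section IS W1's term at the history. [cite: Balaban1987RG1, (1.7) p.261 (bookkeeping)] -/
theorem lastSection_self {M : ℕ} (S : ClusterTower P 𝔸 M) (g : ℕ → ℝ) (j : ℕ) (X : (domSys P M j).Dom) (φ : CPair P 𝔸) :
    lastSection S g j X (g (j - 1)) φ = termC S j X g φ := by
  cases j with
  | zero => rfl
  | succ k => simp [lastSection_succ]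

omit [NormedRing 𝔸] [NormedAlgebra ℂ 𝔸] [CompleteSpace 𝔸] in
/-- The section as the history functional at the updated history. [cite: Balaban1988RG2Cluster, (2.13) p.14 (bookkeeping)] -/
theorem lastSection_succ_eq_functionalC {M : ℕ} (S : ClusterTower P 𝔸 M) (g : ℕ → ℝ) (k : ℕ) (X : (domSys P M (k + 1)).Dom) (t : ℝ) (φ : CPair P 𝔸) :
    lastSection S g (k + 1) X t φ = functionalC S (Function.update g k t) φ ⟨k + 1, X⟩ := rfl

/-- **[I] p. 263 «(or analytic)», HISTORY-EXPLICIT, ON THE W1 OBJECT** (`B12CouplingClausesHistory.AnalyticInLast263` at `E := functionalC S`): the companion of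
W1's `SmoothInLastOfRecord`.  A hypothesis schema; asserted nowhere. [cite: Balaban1987RG1, p.263 (clause before (1.18)) with p.266 (paragraph after (2.9))] -/
def AnalyticInLastOfRecord {M : ℕ} (S : ClusterTower P 𝔸 M) (W : Set (ℕ → ℝ)) (I : Set ℝ) (sp : (j : ℕ) → (domSys P M j).Dom → Set (CPair P 𝔸)) : Prop :=
  B12CouplingClausesHistory.AnalyticInLast263 W I (fun X : W1.Dom P M => X.1) (fun X => sp X.1 X.2) (functionalC S)

/-- **THE SMALL-FIELD TOWER OF W1's TERMS ON THE FRAME OF RECORD** ([I] §1 (1.3)–(1.10) data, `Step.SFTower`): flow `fl` (couplings + β), domains `𝐃_j` OF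
RECORD with `d_j` (`Sect2.domSys`), terms = the last-coupling sections of W1's (2.13) terms at the history `fl.g`, spaces `U^c_j(X, α₀, α₁)` OF RECORD
(`Sect2.spaceI` on the frame of the setting `Sg` and residual recipes `Rz`), backgrounds read through `Sg.ι` with `𝐉 = 0`, the (1.10) action of `Gᶜ`-valued gauge
transformations, locality = agreement on the bonds of `X`, Gaussian normalizations `logZ` ((1.4)–(1.5), not a W1 object: given).  The same frame as def-T's
`Sect2.towerOfTerms` (the [III] §2 tower of record); only the terms come from W1. [cite: Balaban1987RG1, (1.3)-(1.10) pp.260-262; Balaban1988RG2Cluster, (2.13) p.14] -/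
def sfTowerOfRecord (Sg : Setting 𝔸 G) (Rz : Residual P 𝔸) (M : ℕ) (S : ClusterTower P 𝔸 M) (fl : Flow) (logZ : ℕ → GaugeField P 0 G → ℝ) :
    SFTower P G (CPair P 𝔸) (Site P 0 → Sg.𝓜.Gc) where
  flow := fl
  sys := domSys P M
  E := lastSection S fl.g
  space := fun j X α₀ α₁ => spaceI Sg Rz M j (domSites P M j X) α₀ α₁
  ofBackground := ofBackgroundC Sg.ι
  act := fun u => cAct (fun x => (u x : 𝔸ˣ))
  agreeOn := fun j X => agreeOnSet (domSites P M j X)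
  logZ := logZ

variable (Sg : Setting 𝔸 G) (Rz : Residual P 𝔸) (M : ℕ) (S : ClusterTower P 𝔸 M) (fl : Flow) (logZ : ℕ → GaugeField P 0 G → ℝ)

/-- Face: the flow of the tower is the given one. [cite: Balaban1987RG1, (0.18) and (0.20) p.256 (bookkeeping)] -/
theorem sfTowerOfRecord_flow : (sfTowerOfRecord Sg Rz M S fl logZ).flow = fl := rfl
/-- Face: the localization domains of the tower are `𝐃_j` OF RECORD. [cite: Balaban1987RG1, p.257 (class 𝐃_j; bookkeeping)] -/
theorem sfTowerOfRecord_sys : (sfTowerOfRecord Sg Rz M S fl logZ).sys = domSys P M := rfl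
/-- Face: the linear size of the tower is the torus tree length `d_j(X)`. [cite: Balaban1987RG1, p.257 (d_j(X); bookkeeping)] -/
theorem sfTowerOfRecord_dj (j : ℕ) (X : ((sfTowerOfRecord Sg Rz M S fl logZ).sys j).Dom) :
    ((sfTowerOfRecord Sg Rz M S fl logZ).sys j).dj X = torusTreeLen (Subtype.val X : Finset (TPt P.d (domCount P M j))) := rfl
/-- Face: the terms of the tower are the last-coupling sections of W1's terms at the flow's history. [cite: Balaban1987RG1, (1.7) p.261 (bookkeeping)] -/
theorem sfTowerOfRecord_E : (sfTowerOfRecord Sg Rz M S fl logZ).E = lastSection S fl.g := rfl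

/-- **THE NEW TERM OF THE STEP `k → k+1` IS W1's (2.13) TERM in its last coupling**: `E^{(k+1)}(X, t, φ) = E^{(k+1)}(X; g₀,…,g_{k−1}, t; φ)` (`rfl`).
[cite: Balaban1987RG1, (2.13) p.268 with (1.7) p.261; Balaban1988RG2Cluster, (2.13) p.14] -/
theorem sfTowerOfRecord_E_succ (k : ℕ) (X : (domSys P M (k + 1)).Dom) (t : ℝ) (φ : CPair P 𝔸) :
    (sfTowerOfRecord Sg Rz M S fl logZ).E (k + 1) X t φ = termC S (k + 1) X (Function.update fl.g k t) φ := rfl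

/-- … equivalently the step-`k` data's (2.13) at the young couplings `(g₀, …, g_{k−1}, t)`. [cite: Balaban1988RG2Cluster, (2.13) p.14 (bookkeeping)] -/
theorem sfTowerOfRecord_E_succ_eq_E (k : ℕ) (X : (domSys P M (k + 1)).Dom) (t : ℝ) (φ : CPair P 𝔸) :
    (sfTowerOfRecord Sg Rz M S fl logZ).E (k + 1) X t φ = (S k).E (restrictPrefix k (Function.update fl.g k t)) φ X := rfl

/-- Face: no term at creation step `0`. [cite: Balaban1987RG1, (0.23) p.256 (bookkeeping)] -/
theorem sfTowerOfRecord_E_zero (X : (domSys P M 0).Dom) (t : ℝ) (φ : CPair P 𝔸) : (sfTowerOfRecord Sg Rz M S fl logZ).E 0 X t φ = 0 := rfl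

/-- **COHERENCE WITH THE FLOW**: at the flow's own coupling `g_{j−1}` the tower's term IS W1's term at the flow's history — the terms the effective actions
(1.3)∕(1.6)∕(0.23) of the tower sum (`Step.SFTower.Ek`: `E^{(j)}` at `T.flow.g (j−1)`). [cite: Balaban1987RG1, (1.3) p.260 and (0.23) p.256 (bookkeeping)] -/
theorem sfTowerOfRecord_E_self (j : ℕ) (X : (domSys P M j).Dom) (φ : CPair P 𝔸) :
    (sfTowerOfRecord Sg Rz M S fl logZ).E j X (fl.g (j - 1)) φ = termC S j X fl.g φ :=
  lastSection_self S fl.g j X φ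

/-- Face: the spaces of the tower are `U^c_j(X, α₀, α₁)` OF RECORD (`Sect2.spaceI`). [cite: Balaban1987RG1, (1.11)-(1.16) p.262 (bookkeeping)] -/
theorem sfTowerOfRecord_space (j : ℕ) (X : (domSys P M j).Dom) (α₀ α₁ : ℝ) :
    (sfTowerOfRecord Sg Rz M S fl logZ).space j X α₀ α₁ = spaceI Sg Rz M j (domSites P M j X) α₀ α₁ := rfl

/-- The spaces of the tower at a level table `(α₀(j), α₁(j))` are W1's space table of record. [cite: Balaban1987RG1, (1.11)-(1.16) p.262 (bookkeeping)] -/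
theorem sfTowerOfRecord_space_eq_spaceOfRecord (α₀ α₁ : ℕ → ℝ) (j : ℕ) (X : (domSys P M j).Dom) :
    (sfTowerOfRecord Sg Rz M S fl logZ).space j X (α₀ j) (α₁ j) = spaceOfRecord Sg Rz α₀ α₁ j X := rfl

/-- Face: backgrounds enter through `Sg.ι` with `𝐉 = 0`. [cite: Balaban1987RG1, (1.9) pp.261-262 (bookkeeping)] -/
theorem sfTowerOfRecord_ofBackground (U : GaugeField P 0 G) : (sfTowerOfRecord Sg Rz M S fl logZ).ofBackground U = ofBackgroundC Sg.ι U := rfl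
/-- Face: the gauge action of the tower is (1.10) on the configuration pairs. [cite: Balaban1987RG1, (1.10) p.262 (bookkeeping)] -/
theorem sfTowerOfRecord_act (u : Site P 0 → Sg.𝓜.Gc) (φ : CPair P 𝔸) :
    (sfTowerOfRecord Sg Rz M S fl logZ).act u φ = cAct (fun x => (u x : 𝔸ˣ)) φ := rfl
/-- Face: locality in the tower IS agreement on the bonds of `X`. [cite: Balaban1987RG1, (1.7) p.261 (bookkeeping)] -/
theorem sfTowerOfRecord_agreeOn (j : ℕ) (X : (domSys P M j).Dom) (φ ψ : CPair P 𝔸) :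
    (sfTowerOfRecord Sg Rz M S fl logZ).agreeOn j X φ ψ ↔ agreeOnSet (domSites P M j X) φ ψ := Iff.rfl
/-- Face: the Gaussian normalizations are the given ones. [cite: Balaban1987RG1, (1.4)-(1.5) p.260 (bookkeeping)] -/
theorem sfTowerOfRecord_logZ : (sfTowerOfRecord Sg Rz M S fl logZ).logZ = logZ := rfl

/-- The tower of W1's terms has the frame of def-T's §2 tower of record (same `sys`, `space`, `ofBackground`, `act`, `agreeOn`). [cite: Balaban1988Convergent, (2.23)-(2.27) pp.258-259 (bookkeeping)] -/
theorem sfTowerOfRecord_frame_eq_towerOfTerms {V : Type*} (Ω : ℕ → Set (Site P 0)) (t : TermValues P 𝔸 V M) (hfl : fl = Sg.flow) :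
    (sfTowerOfRecord Sg Rz M S fl logZ).sys = (towerOfTerms Sg Rz M Ω t).sys ∧
      (sfTowerOfRecord Sg Rz M S fl logZ).space = (towerOfTerms Sg Rz M Ω t).space ∧
      (sfTowerOfRecord Sg Rz M S fl logZ).ofBackground = (towerOfTerms Sg Rz M Ω t).ofBackground ∧
      (sfTowerOfRecord Sg Rz M S fl logZ).act = (towerOfTerms Sg Rz M Ω t).act ∧
      (sfTowerOfRecord Sg Rz M S fl logZ).agreeOn = (towerOfTerms Sg Rz M Ω t).agreeOn ∧
      (sfTowerOfRecord Sg Rz M S fl logZ).flow = (towerOfTerms Sg Rz M Ω t).flow :=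
  ⟨rfl, rfl, rfl, rfl, rfl, hfl⟩

/-- **`𝐄^{(k+1)}(t, φ) = Σ_{X ∈ 𝐃_{k+1}} E^{(k+1)}(X; g₀,…,g_{k−1}, t; φ)`** ((1.7) of the tower on W1's terms). [cite: Balaban1987RG1, (1.7) p.261 (bookkeeping)] -/
theorem Etot_sfTowerOfRecord_succ (k : ℕ) (t : ℝ) (φ : CPair P 𝔸) :
    (sfTowerOfRecord Sg Rz M S fl logZ).Etot (k + 1) t φ = ∑ X : (domSys P M (k + 1)).Dom, termC S (k + 1) X (Function.update fl.g k t) φ := rfl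

/-- **(0.23) ON W1's TERMS**: the sum `𝐄_K(U)` of the tower reads, at every `j < K`, W1's terms at the flow's OWN history (coherence `sfTowerOfRecord_E_self`).
[cite: Balaban1987RG1, (0.23) p.256 and (1.6) p.261 (bookkeeping)] -/
theorem Ek_sfTowerOfRecord (K : ℕ) (U : GaugeField P 0 G) :
    (sfTowerOfRecord Sg Rz M S fl logZ).Ek K U =
      ∑ j ∈ Finset.range K,
        (-(fl.β (j + 1) (fl.g j)) * wilsonAction4 U +
          ((∑ X : (domSys P M (j + 1)).Dom, termC S (j + 1) X fl.g (ofBackgroundC Sg.ι U)).re -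
            (∑ X : (domSys P M (j + 1)).Dom, termC S (j + 1) X fl.g (ofBackgroundC Sg.ι 1)).re)) := by
  unfold SFTower.Ek SFTower.Etot
  refine Finset.sum_congr rfl fun j _ => ?_
  show -(fl.β (j + 1) (fl.g j)) * wilsonAction4 U +
      ((∑ X : (domSys P M (j + 1)).Dom, termC S (j + 1) X (Function.update fl.g j (fl.g j)) (ofBackgroundC Sg.ι U)).re -
        (∑ X : (domSys P M (j + 1)).Dom, termC S (j + 1) X (Function.update fl.g j (fl.g j)) (ofBackgroundC Sg.ι 1)).re) = _
  rw [Function.update_eq_self]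

/-! ### The located clauses of `Step.SFHyp` the W1 object discharges BY NAME -/

/-- **(1.7) «the term corresponding to a domain X depends on U_j restricted to X» FOR THE TOWER OF W1's TERMS** from localized activities
(`ClusterStep.LocalizedH` at every step): the `localDep` clause of `Step.SFHyp` at every level. [cite: Balaban1987RG1, (1.7) p.261 and §1 p.263; Balaban1988RG2Cluster, p.15] -/
theorem sfTowerOfRecord_localDep (hloc : ∀ k, (S k).LocalizedH) (j : ℕ) (X : (domSys P M j).Dom) (t : ℝ) (φ ψ : CPair P 𝔸)
    (h : (sfTowerOfRecord Sg Rz M S fl logZ).agreeOn j X φ ψ) :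
    (sfTowerOfRecord Sg Rz M S fl logZ).E j X t φ = (sfTowerOfRecord Sg Rz M S fl logZ).E j X t ψ := by
  cases j with
  | zero => rfl
  | succ k => exact (S k).E_localized (hloc k) _ X h

/-- **(1.19) «E^{(j)}(X, g_{j−1}, 𝐔^u, R(u)𝐉) = E^{(j)}(X, g_{j−1}, 𝐔, 𝐉)» FOR THE TOWER OF W1's TERMS** from gauge-invariant activities (`ClusterStep.GaugeInvH`
on a set `𝒰` containing the `Gᶜ`-valued transformations): the `gaugeInv119` clause of `Step.SFHyp` at every level. [cite: Balaban1987RG1, (1.19) p.263; Balaban1988RG2Cluster, pp.21-22] -/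
theorem sfTowerOfRecord_gaugeInv119 {𝒰 : Set (Site P 0 → 𝔸ˣ)} (hinv : ∀ k, (S k).GaugeInvH 𝒰)
    (h𝒰 : ∀ u : Site P 0 → Sg.𝓜.Gc, (fun x => (u x : 𝔸ˣ)) ∈ 𝒰) (j : ℕ) (X : (domSys P M j).Dom) (t : ℝ) (u : Site P 0 → Sg.𝓜.Gc)
    (φ : CPair P 𝔸) :
    (sfTowerOfRecord Sg Rz M S fl logZ).E j X t ((sfTowerOfRecord Sg Rz M S fl logZ).act u φ) = (sfTowerOfRecord Sg Rz M S fl logZ).E j X t φ := by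
  cases j with
  | zero => rfl
  | succ k => exact (S k).E_gaugeInv (hinv k) (h𝒰 u) _ φ X

/-! ### Node N09's per-step currency `B12BetaHolo.EHoloAt` ON W1's TERMS -/

/-- **`EHoloAt` FOR THE TOWER OF W1's TERMS, FIELD BY FIELD** (the constructor, documenting the reading): an open `U ⊇` the closed `r`-discs about `[0, γ]`, per
`(X, φ ∈ U^c_{k+1}(X, α₀, α₁))` a function `Ec X φ` holomorphic on `U` whose trace on `[0, γ]` is `t ↦ E^{(k+1)}(X; g₀,…,g_{k−1}, t; φ)` and which obeys (1.18)
on `U`. [cite: Balaban1987RG1, p.263 (clause before (1.18)) with p.266 (analytic alternative)] -/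
def eHoloAtOfRecord (c : SFConsts) (k : ℕ) (U : Set ℂ) (hU : IsOpen U) (r : ℝ) (hr : 0 < r)
    (hball : ∀ t ∈ Set.Icc (0 : ℝ) c.γ, Metric.closedBall (t : ℂ) r ⊆ U) (Ec : (domSys P M (k + 1)).Dom → CPair P 𝔸 → ℂ → ℂ)
    (holo : ∀ X φ, φ ∈ spaceI Sg Rz M (k + 1) (domSites P M (k + 1) X) c.α₀ c.α₁ → DifferentiableOn ℂ (Ec X φ) U)
    (heq : ∀ X φ, φ ∈ spaceI Sg Rz M (k + 1) (domSites P M (k + 1) X) c.α₀ c.α₁ →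
      ∀ t ∈ Set.Icc (0 : ℝ) c.γ, termC S (k + 1) X (Function.update fl.g k t) φ = Ec X φ t)
    (E₀ : ℝ) (bound : ∀ X φ, φ ∈ spaceI Sg Rz M (k + 1) (domSites P M (k + 1) X) c.α₀ c.α₁ →
      ∀ z ∈ U, ‖Ec X φ z‖ ≤ E₀ * Real.exp (-c.κ * torusTreeLen (Subtype.val X : Finset (TPt P.d (domCount P M (k + 1)))))) :
    EHoloAt (sfTowerOfRecord Sg Rz M S fl logZ) c k :=
  ⟨U, hU, r, hr, hball, Ec, holo, heq, E₀, bound⟩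

/-- **WHAT `EHoloAt` ON W1's TERMS DELIVERS, IN W1's LETTERS** (the shape of dag-n22-c's last-coupling socket `hlast` of
`…N22W1StripInductionLetters.stepOut_of_propagationOlder_lastOut`, per `(k, g, X, φ)`, from a family of N09's deliverables along the admissible histories with
uniform letters `(E₀, r)`): for every run length ∕ step `k`, history `g ∈ Window γ` (`γ ≤` the tower's `γ`), domain `X ∈ 𝐃_{k+1}` and `φ ∈ U^c_{k+1}(X, α₀, α₁)`
there are `Ec` and an open `O ⊇` the closed `r`-discs about `]0, γ]` with `Ec` holomorphic on `O`, `‖Ec‖ ≤ E₀ e^{−κ d_{k+1}(X)}` on `O`, and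
`Ec t = E^{(k+1)}(X; g₀,…,g_{k−1}, t; φ)` for `t ∈ ]0, γ]`. [cite: Balaban1987RG1, p.263 (clause before (1.18)) with p.266; Balaban1988RG2Cluster, (2.13) p.14] -/
theorem lastOut_of_eHoloAt (β : ℕ → ℝ → ℝ) {c : SFConsts} {γ r E₀ : ℝ} (hγ : γ ≤ c.γ)
    (hE : ∀ g ∈ Window γ, ∀ k : ℕ, ∃ H : EHoloAt (sfTowerOfRecord Sg Rz M S ⟨g, β⟩ logZ) c k, H.E₀ ≤ E₀ ∧ r ≤ H.r) :
    ∀ (k : ℕ) (g : ℕ → ℝ), g ∈ Window γ → ∀ (X : (domSys P M (k + 1)).Dom) (φ : CPair P 𝔸),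
      φ ∈ spaceI Sg Rz M (k + 1) (domSites P M (k + 1) X) c.α₀ c.α₁ →
      ∃ (Ec : ℂ → ℂ) (O : Set ℂ), IsOpen O ∧ (∀ t ∈ Set.Ioc (0 : ℝ) γ, Metric.closedBall (t : ℂ) r ⊆ O) ∧ DifferentiableOn ℂ Ec O ∧
        (∀ z ∈ O, ‖Ec z‖ ≤ E₀ * Real.exp (-(c.κ * torusTreeLen (Subtype.val X : Finset (TPt P.d (domCount P M (k + 1))))))) ∧
        (∀ t ∈ Set.Ioc (0 : ℝ) γ, Ec t = termC S (k + 1) X (Function.update g k t) φ) := by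
  intro k g hg X φ hφ
  obtain ⟨H, hE₀, hr⟩ := hE g hg k
  have hI : ∀ t ∈ Set.Ioc (0 : ℝ) γ, t ∈ Set.Icc (0 : ℝ) c.γ := fun t ht => ⟨ht.1.le, ht.2.trans hγ⟩
  refine ⟨H.Ec X φ, H.U, H.isOpen, fun t ht => (Metric.closedBall_subset_closedBall hr).trans (H.ball_subset t (hI t ht)),
    H.holo X φ hφ, fun z hz => ?_, fun t ht => (H.eq X φ hφ t (hI t ht)).symm⟩
  have hb := H.bound X φ hφ z hz
  rw [neg_mul] at hb
  exact hb.trans (mul_le_mul_of_nonneg_right hE₀ (Real.exp_pos _).le)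

/-- The `eq` field in W1's letters: `E^{(k+1)}(X; g₀,…,g_{k−1}, t; φ) = Ec X φ t` on `[0, γ]`. [cite: Balaban1987RG1, p.263 (clause before (1.18)) (bookkeeping)] -/
theorem termC_update_eq_of_eHoloAt {c : SFConsts} {k : ℕ} (H : EHoloAt (sfTowerOfRecord Sg Rz M S fl logZ) c k)
    (X : (domSys P M (k + 1)).Dom) (φ : CPair P 𝔸) (hφ : φ ∈ spaceI Sg Rz M (k + 1) (domSites P M (k + 1) X) c.α₀ c.α₁) {t : ℝ}
    (ht : t ∈ Set.Icc (0 : ℝ) c.γ) : termC S (k + 1) X (Function.update fl.g k t) φ = H.Ec X φ t :=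
  H.eq X φ hφ t ht

/-- **(1.18) FOR W1's NEW TERM AT EVERY REAL LAST COUPLING `t ∈ [0, γ]`** from N09's currency: `‖E^{(k+1)}(X; g₀,…,g_{k−1}, t; φ)‖ ≤ E₀ e^{−κ d_{k+1}(X)}`.
[cite: Balaban1987RG1, (1.18) p.263] -/
theorem norm_termC_update_le_of_eHoloAt {c : SFConsts} {k : ℕ} (H : EHoloAt (sfTowerOfRecord Sg Rz M S fl logZ) c k)
    (X : (domSys P M (k + 1)).Dom) (φ : CPair P 𝔸) (hφ : φ ∈ spaceI Sg Rz M (k + 1) (domSites P M (k + 1) X) c.α₀ c.α₁) {t : ℝ}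
    (ht : t ∈ Set.Icc (0 : ℝ) c.γ) :
    ‖termC S (k + 1) X (Function.update fl.g k t) φ‖ ≤
      H.E₀ * Real.exp (-(c.κ * torusTreeLen (Subtype.val X : Finset (TPt P.d (domCount P M (k + 1)))))) := by
  rw [termC_update_eq_of_eHoloAt Sg Rz M S fl logZ H X φ hφ ht, ← neg_mul]
  exact H.bound X φ hφ _ (H.ball_subset t ht (Metric.mem_closedBall_self H.r_pos.le))

/-- **(1.18) FOR W1's NEW TERM AT THE FLOW's OWN HISTORY** (`g_k ∈ [0, γ]`): `‖E^{(k+1)}(X; g₀,…,g_k; φ)‖ ≤ E₀ e^{−κ d_{k+1}(X)}`. [cite: Balaban1987RG1, (1.18) p.263] -/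
theorem norm_termC_le_of_eHoloAt {c : SFConsts} {k : ℕ} (H : EHoloAt (sfTowerOfRecord Sg Rz M S fl logZ) c k)
    (hg : fl.g k ∈ Set.Icc (0 : ℝ) c.γ) (X : (domSys P M (k + 1)).Dom) (φ : CPair P 𝔸)
    (hφ : φ ∈ spaceI Sg Rz M (k + 1) (domSites P M (k + 1) X) c.α₀ c.α₁) :
    ‖termC S (k + 1) X fl.g φ‖ ≤ H.E₀ * Real.exp (-(c.κ * torusTreeLen (Subtype.val X : Finset (TPt P.d (domCount P M (k + 1)))))) := by
  have h := norm_termC_update_le_of_eHoloAt Sg Rz M S fl logZ H X φ hφ hg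
  rwa [Function.update_eq_self] at h

/-- **W1's `TermBound118` ((1.18) FOR EVERY TERM OF THE TOWER ALONG THE ADMISSIBLE HISTORIES) from N09's currency with a uniform letter `E₀`**:
histories inside `[0, γ]^ℕ`, one `EHoloAt` per (history, step) with `E₀`-fields `≤ E₀`. [cite: Balaban1987RG1, (1.18) p.263 and Thm 1 p.259] -/
theorem termBound118_of_eHoloAt (β : ℕ → ℝ → ℝ) {c : SFConsts} {W : Set (ℕ → ℝ)} {E₀ : ℝ} (hE₀ : 0 ≤ E₀)
    (hW : ∀ g ∈ W, ∀ i, g i ∈ Set.Icc (0 : ℝ) c.γ)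
    (hE : ∀ g ∈ W, ∀ k : ℕ, ∃ H : EHoloAt (sfTowerOfRecord Sg Rz M S ⟨g, β⟩ logZ) c k, H.E₀ ≤ E₀) :
    TermBound118 S W (fun j X => spaceI Sg Rz M j (domSites P M j X) c.α₀ c.α₁) E₀ c.κ := by
  intro g hg j X φ hφ
  cases j with
  | zero =>
    rw [termC_zero, norm_zero]
    exact mul_nonneg hE₀ (Real.exp_pos _).le
  | succ k =>
    obtain ⟨H, hH⟩ := hE g hg k
    exact (norm_termC_le_of_eHoloAt Sg Rz M S ⟨g, β⟩ logZ H (hW g hg k) X φ hφ).trans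
      (mul_le_mul_of_nonneg_right hH (Real.exp_pos _).le)

/-- **Along a window `]0, γ′]^ℕ` with `γ′ ≤ γ`** (Theorem 1's histories): the same. [cite: Balaban1987RG1, Thm 1 p.259 and (1.18) p.263] -/
theorem termBound118_window_of_eHoloAt (β : ℕ → ℝ → ℝ) {c : SFConsts} {γ E₀ : ℝ} (hγ : γ ≤ c.γ) (hE₀ : 0 ≤ E₀)
    (hE : ∀ g ∈ Window γ, ∀ k : ℕ, ∃ H : EHoloAt (sfTowerOfRecord Sg Rz M S ⟨g, β⟩ logZ) c k, H.E₀ ≤ E₀) :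
    TermBound118 S (Window γ) (fun j X => spaceI Sg Rz M j (domSites P M j X) c.α₀ c.α₁) E₀ c.κ :=
  termBound118_of_eHoloAt Sg Rz M S logZ β hE₀ (fun _ hg i => ⟨(hg i).1.le, (hg i).2.trans hγ⟩) hE

/-! ### [I] p. 263 «C^∞ in g_{j−1} (or analytic)» ON THE W1 OBJECT from N09's currency along the admissible histories -/

/-- **THE SMOOTHNESS CLAUSE OF THE STEP AT EVERY ADMISSIBLE HISTORY IS [I] p. 263's C^∞ CLAUSE ON THE W1 OBJECT**: `ESmoothAt` of the tower of W1's terms at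
`⟨h, β⟩` for every `h ∈ W` and every `k` ⟺ `W1.SmoothInLastOfRecord S W [0, γ]` on the space table `U^c_j(X, α₀, α₁)` of record. [cite: Balaban1987RG1, p.263 (clause before (1.18))] -/
theorem smoothInLastOfRecord_iff_eSmoothAt (β : ℕ → ℝ → ℝ) (c : SFConsts) (W : Set (ℕ → ℝ)) :
    SmoothInLastOfRecord S W (Set.Icc 0 c.γ) (fun j X => spaceI Sg Rz M j (domSites P M j X) c.α₀ c.α₁) ↔
      ∀ h ∈ W, ∀ k, ESmoothAt (sfTowerOfRecord Sg Rz M S ⟨h, β⟩ logZ) c k := by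
  constructor
  · intro hS h hh k X φ hφ n
    exact hS ⟨k + 1, X⟩ φ hφ h hh k rfl n
  · rintro hS ⟨j, X⟩ φ hφ h hh i hi n
    dsimp only at hi
    subst hi
    exact hS h hh i X φ hφ n

/-- The analytic twin: `EAnalyticAt` at every admissible history ⟺ `W1.AnalyticInLastOfRecord S W [0, γ]` on the space table of record. [cite: Balaban1987RG1, p.263 with p.266 (paragraph after (2.9))] -/
theorem analyticInLastOfRecord_iff_eAnalyticAt (β : ℕ → ℝ → ℝ) (c : SFConsts) (W : Set (ℕ → ℝ)) :
    AnalyticInLastOfRecord S W (Set.Icc 0 c.γ) (fun j X => spaceI Sg Rz M j (domSites P M j X) c.α₀ c.α₁) ↔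
      ∀ h ∈ W, ∀ k, EAnalyticAt (sfTowerOfRecord Sg Rz M S ⟨h, β⟩ logZ) c k := by
  constructor
  · intro hS h hh k X φ hφ
    exact hS ⟨k + 1, X⟩ φ hφ h hh k rfl
  · rintro hS ⟨j, X⟩ φ hφ h hh i hi
    dsimp only at hi
    subst hi
    exact hS h hh i X φ hφ

/-- **N09's HOLOMORPHIC CURRENCY ALONG THE ADMISSIBLE HISTORIES ⟹ BOTH p. 263 CLAUSES ON THE W1 OBJECT** (`EHoloAt.eSmoothAt`, `EHoloAt.eAnalyticAt` of node N09's
`B12BetaHolo`, read through the dictionary). [cite: Balaban1987RG1, p.263 (clause before (1.18)) with p.266] -/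
theorem smooth_and_analyticInLastOfRecord_of_eHoloAt (β : ℕ → ℝ → ℝ) (c : SFConsts) (W : Set (ℕ → ℝ))
    (hE : ∀ h ∈ W, ∀ k, Nonempty (EHoloAt (sfTowerOfRecord Sg Rz M S ⟨h, β⟩ logZ) c k)) :
    SmoothInLastOfRecord S W (Set.Icc 0 c.γ) (fun j X => spaceI Sg Rz M j (domSites P M j X) c.α₀ c.α₁) ∧
      AnalyticInLastOfRecord S W (Set.Icc 0 c.γ) (fun j X => spaceI Sg Rz M j (domSites P M j X) c.α₀ c.α₁) :=
  ⟨(smoothInLastOfRecord_iff_eSmoothAt Sg Rz M S logZ β c W).2 fun h hh k => (hE h hh k).elim fun H => H.eSmoothAt,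
    (analyticInLastOfRecord_iff_eAnalyticAt Sg Rz M S logZ β c W).2 fun h hh k => (hE h hh k).elim fun H => H.eAnalyticAt⟩

end SF

end W1

end Literature.MathematicalPhysics.QuantumFieldTheory.Balaban1983to89.Node00
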